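import Summits.BirchSwinnertonDyer.Rank1Residual.X1.RankOneLeadingTermSqueeze
import Summits.BirchSwinnertonDyer.Rank1Residual.X1.RankOneCoefficientCertificate
import HarnessLib

/-!
# Route R on X1 ∩ {r = 1} — the REGULATOR squeeze: `ord_p [T¹](ϖ·L_p) + 1 + 2·ord_p #E(ℚ)_tors
# ≤ ord_p Reg_p + ord_p ∏c_ℓ + 2·ord_p #Ẽ(𝔽_p)` ⇒ Mazur's main conjecture ∧ `Ш(E/ℚ)[p^∞] = 0` ∧ `BSD(E,p)`

HONEST FRAMING (cell `b2b-bsdres`, run/shared/lean/b2b/bsd-rank1-residual/, verbatim in every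
file): the goal of the cell is to DELETE the COMBINATION-SHAPED residual classes of the
Birch–Swinnerton-Dyer formula for ALL analytic-rank `≤ 1` elliptic curves over `ℚ` — "full BSD
formula for every rank `≤ 1` curve in class `C`" assembled STRICTLY from published theorems — so
that the rank-`≤ 1` remainder becomes exactly the CONSTRUCTION-SHAPED classes, which are TYPED
(missing-input `Prop`s), NOT attempted. This is not "finishing BSD". CLASS-OWNERS.md: row
"X1 (r = 1)" — research route; NO CLAIM BEYOND STATED CLASSES; no label change. PER-PAIR certificate
shape, not a class theorem; nothing is booked by this file; no preprint enters.

Unit `b2b-bsdres-x1a` (X1 prover A, gen 16). Sequel of `X1/RankOneLeadingTermSqueeze.lean` (gen 15,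
route E) and of x1b's `X1/RankOneParitySqueezeLeaf.lean` (route P₃). NO definition, NO named fact:
theorems over the PUBLISHED named facts Wuthrich 2014 Thm. 16 (`hW16`), Perrin-Riou–Schneider at odd
`p` (`hS`, Balakrishnan–Müller–Stein Thm. 1.7, ALL THREE clauses), Mazur–Tate `σ` (`hMT`), Perrin-Riou
1987 (`hPR`, only for the final step MC ⇒ `BSD(E,p)`), modularity (`hmod`), Gross–Zagier–Kolyvagin
(`hGZK`), Cassels (`hCassels`, isogeny form only), and the cell's typed per-pair datum
`AnalyticCoeffOneVal W p v` (gen 15).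

## The observation, and the proof

Every rank-one route so far avoids the VALUE of the `p`-adic regulator: route B reads `p ∤ #Ш(E/ℚ)_an`
(COMPLEX-analytic, not a finite certificate at rank one) plus the Schneider certificate; the
"`#Ш_an`-free" union (P₁/P₃/G/T⁺/D/E/N: 8 538 / 8 882 type-A rank-one X1 classes at `p = 3`,
`N < 5·10⁵`, gen 15) reads Iwasawa invariants, factor patterns, descent witnesses and structural lower
bounds; x1b's route P₃ uses a regulator LOWER BOUND, but only at `λ_an = 3`. Yet the cell holds the
valuation of THE canonical cyclotomic `p`-adic regulator from TWO engines (x1b engine 3 =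
Mazur–Stein–Tate `σ`-height; PARI 2.17 `ellpadicregulator`; `p`-saturation two-engine, x1a gen 12) for
all 12 315 rank-one X1 class-pairs `N < 5·10⁵`, and x1a gen 10 verified
`ord_p c₁ = ord_p Reg_p + 2·ord_p #Ẽ(𝔽_p) − 2·ord_p #E(ℚ)_tors + ord_p ∏c_ℓ + ord_p #Ш_an − 1` at
12 222 / 12 222 certified pairs (HOME/b2b-bsdres-x1a/gen10/LW-FALLOUT-X1.md §6) as a "consistency check".
It is a PROOF. Write `ϖ·L_p = ι(f_E·h)` (Wuthrich Thm. 16, `h ∈ Λ`). At rank one `f_E(0) = 0` (BMS 1.7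
(1)), so `c₁ := [T¹](ϖ·L_p) = [T¹]f_E · h(0)`; `c₁ ≠ 0` forces `ord_{T=0} f_E = 1 = rank E(ℚ)`, whence
(BMS 1.7 (2)–(3)) Schneider's non-degeneracy, `Ш(E/ℚ)[p^∞]` finite, and (`ord_p log_p(γ) = 1`,
`ord_p(1 − α⁻¹) = ord_p #Ẽ(𝔽_p)`) the IDENTITY
  `s := ord_p c₁ + 1 + 2·ord_p #E(ℚ)_tors − 2·ord_p #Ẽ(𝔽_p) − ord_p ∏c_ℓ − ord_p Reg_p
     = ord_p #Ш(E/ℚ)[p^∞] + ord_p h(0)`,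
a sum of two non-negative integers (§2 `identity`; so `ord_p #Ш(E/ℚ)[p^∞] ≤ s` unconditionally —
Kato's direction at a REDUCIBLE prime; sequel file). If `s ≤ 0` — in lower-bound currency `ord_p c₁ + 1 +
2·ord_p #tors ≤ v + ord_p ∏c_ℓ + 2·ord_p #Ẽ(𝔽_p)` with `v ≤ ord_p Reg_p` — then `h(0) ∈ ℤ_pˣ`,
`h ∈ Λˣ`, `char X = (ϖ·L_p)`: MAZUR'S MAIN CONJECTURE, `Ш(E/ℚ)[p^∞] = 0`, `ord_p Reg_p = v`, and
`BSD(E,p)` (x1a's `RankOne.Leaf.bsdp_of_mazurMainConjecture_of_schneider`, `c₁ ≠ 0` being the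
certificate). No `λ_an`, `μ_an`, parity, descent, `λ_alg`-bound or `#Ш(E/ℚ)_an`: the rank-one twin of
eisenstein-p1's `ConstantTermSqueeze.mazurMainConjecture_of_constCoeffVal_le`, and route P₃ without its
case analysis. TIER, honestly: granted Perrin-Riou 1987 + Gross–Zagier, `s = ord_p #Ш(E/ℚ)_an` (x1b's
`Wuthrich2014.exists_cofactor_of_mem_charIdeal_of_rank_one_odd`), so route R fires EXACTLY where route B
would — in certificate currency (one modular-symbol coefficient, one `σ`-height of a `p`-saturated
generator). Census (x1a gen 16, HOME/b2b-bsdres-x1a/gen16/ROUTE-R-R1.md): `s = 0` at member 1 for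
8 827 / 8 882 type-A rank-one X1 classes at `p = 3`, `N < 5·10⁵` (`vc ≠ 0` at 7 325, `vc = 0` = route
P₁ at 1 502), 544/552 at `p = 5`, 66/67 at `7`, 15/17 at `13`; residue at `3` with the isogeny form: 3.

References: [Wuthrich2014] Thm. 16 (p. 397); [BalakrishnanMullerStein2015] Thm. 1.7;
[MazurSteinTate2006] Thm. 1.3, §4; [Balakrishnan2016] §2; [PerrinRiou1987] §1.4 Cor. 1.8;
[SteinWuthrich2013] §§3–4, §9, Thm. 6.1; [GreenbergLNM1716] §5 p. 131; [MilneADT2006] Thm. I.7.3;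
HOME/b2b-bsdres-x1a/gen10/LW-FALLOUT-X1.md §6; HOME/b2b-bsdres-x1a/X1-CHAIN.md §25.
-/

noncomputable section

open scoped Classical MatrixGroups ModularForm

open PowerSeries CongruenceSubgroup WeierstrassCurve Literature.NumberTheory.EllipticCurves
  Literature.NumberTheory.EllipticCurves.ModularForms
  Literature.NumberTheory.EllipticCurves.Wuthrich2014
  Literature.NumberTheory.EllipticCurves.Rank1Residual
  Summit.BirchSwinnertonDyer.BirchSwinnertonDyer.Theorems
  Summit.BirchSwinnertonDyer.BirchSwinnertonDyer.Theorems.Rank1ResidualX1Defs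
  Summit.BirchSwinnertonDyer.Rank1Residual.X1.MuLambda
  Summit.BirchSwinnertonDyer.Rank1Residual.X1.EisensteinSqueeze
  Summit.BirchSwinnertonDyer.Rank1Residual.X1.RankOneLeadingTermSqueeze

set_option autoImplicit false

namespace Summit.BirchSwinnertonDyer.Rank1Residual.X1.RankOneRegulatorSqueeze

/-! ## §1. `Λ`-algebra: valuations add in `[T¹](g·h) = [T¹]g · h(0)` -/

section Algebra

variable {p : ℕ} [Fact p.Prime]

/-- **`ord_p [T¹](g·h) = ord_p [T¹]g + ord_p h(0)` when `g(0) = 0` and `[T¹](g·h) ≠ 0`** (then both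
factors are non-zero; Cauchy product in `Λ = ℤ_p⟦T⟧`, `RankOneLeadingTermSqueeze.coeff_one_mul_of_constantCoeff_eq_zero`).
[folklore] -/
theorem valuation_coeff_one_mul_eq {g h : IwasawaAlgebra p} (hg0 : constantCoeff g = 0)
    (hne : coeff 1 (g * h) ≠ 0) :
    coeff 1 g ≠ 0 ∧ constantCoeff h ≠ 0 ∧
      ((coeff 1 (g * h) : ℤ_[p]) : ℚ_[p]).valuation =
        ((coeff 1 g : ℤ_[p]) : ℚ_[p]).valuation + ((constantCoeff h : ℤ_[p]) : ℚ_[p]).valuation := by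
  rw [coeff_one_mul_of_constantCoeff_eq_zero hg0] at hne ⊢
  have hg1 : coeff 1 g ≠ 0 := fun h0 ↦ hne (by rw [h0, zero_mul])
  have hh0 : constantCoeff h ≠ 0 := fun h0 ↦ hne (by rw [h0, mul_zero])
  refine ⟨hg1, hh0, ?_⟩
  rw [PadicInt.coe_mul, Padic.valuation_mul (PadicInt.coe_ne_zero.mpr hg1)
    (PadicInt.coe_ne_zero.mpr hh0)]

end Algebra

/-! ## §2. One cyclotomic datum: the valuation IDENTITY, the squeeze, Mazur's main conjecture -/

section Squeeze

variable {W : WeierstrassCurve ℚ} [W.IsElliptic] [W.IsGloballyMinimal] {p : ℕ} [Fact p.Prime]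

/-- **The rank-one valuation identity at one cyclotomic datum (no size hypothesis).** `W/ℚ` globally
minimal elliptic, `p ≠ 2` good ordinary, `E[p]` reducible, `rank E(ℚ) = 1`, `ord_p [T¹](ϖ·L_p) = vc ≠ 0`
(`AnalyticCoeffOneVal W p vc`); PUBLISHED facts Wuthrich 2014 Thm. 16 (`hW16`), BMS Thm. 1.7 at odd `p`
(`hS`, all three clauses), Mazur–Tate `σ` (`hMT`). Then `X` is torsion, `Ш(E/ℚ)[p^∞]` is finite, and
with `char X = (f_E)`, `ϖ·L_p = ι(f_E·h)`: at EVERY canonical height datum Schneider holds and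
`ord_p #Ш(E/ℚ)[p^∞] + ord_p h(0) + ord_p Reg_p + ord_p ∏c_ℓ + 2·ord_p #Ẽ(𝔽_p) = vc + 1 + 2·ord_p #E(ℚ)_tors`,
`ord_p h(0) ≥ 0`. [cite: Wuthrich2014, Thm. 16 (p. 397)] [cite: BalakrishnanMullerStein2015, Thm. 1.7]
[cite: MazurSteinTate2006, Thm. 1.3] [cite: Balakrishnan2016, §2] [cite: Iwasawa1972PadicL, §4.4] -/
theorem identity (hW16 : Wuthrich2014.charIdeal_dvd_padicLFunction)
    (hS : Schneider1985_order_charGenerator_odd) (hMT : mazur_tate_sigma_exists_odd) (hp : p ≠ 2)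
    (hgood : W.HasGoodReductionAtPrime p) (hord : ¬ (p : ℤ) ∣ W.frobeniusTrace p)
    (hred : ¬ W.HasIrreducibleModPGaloisRep p) (hrk : W.mordellWeilRank = 1)
    {vc : ℤ} (hvc : vc ≠ 0) (hc : AnalyticCoeffOneVal W p vc)
    {κ : ZpExtension ℚ p} {γ : Field.absoluteGaloisGroup ℚ}
    (hκ : κ.IsCyclotomic) (hγ : κ.IsTopGenerator γ) (hγ' : IsCyclotomicVariable p γ)
    [NeZero (W.conductorNorm ℤ)] {f : CuspForm (Gamma0 (W.conductorNorm ℤ)) 2} (hf : IsNewformOf W f)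
    {ϖ : ℚ} (hϖ : (ϖ : ℝ) * W.realPeriodRat = plusPeriod f) (D : W.SelmerDualData κ γ)
    [Module.Finite (IwasawaAlgebra p) D.X] :
    D.IsTorsion ∧ Finite (AddCommGroup.primaryComponent W.sha p) ∧
      ∃ fE h : IwasawaAlgebra p, D.charIdeal = Ideal.span {fE} ∧ fE ≠ 0 ∧
        iwasawaToPowerSeries p (fE * h) = C (ϖ : ℚ_[p]) * padicLFunction f (unitRoot W p : ℚ_[p]) ∧
        constantCoeff h ≠ 0 ∧ 0 ≤ ((constantCoeff h : ℤ_[p]) : ℚ_[p]).valuation ∧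
        ∀ Dh : PAdicHeightData W p, Dh.IsCanonical → SchneiderConjecture Dh ∧
          (padicValNat p (Nat.card (AddCommGroup.primaryComponent W.sha p)) : ℤ) +
              ((constantCoeff h : ℤ_[p]) : ℚ_[p]).valuation + (padicRegulator Dh).valuation +
              padicValNat p W.tamagawaProduct + 2 * padicValNat p (W.reductionPointCount p) =
            vc + 1 + 2 * padicValNat p W.torsionOrder := by
  have hpP : p.Prime := Fact.out
  have hordp : IsOrdinaryAt W p := ⟨hgood, hord⟩
  -- Wuthrich Thm. 16: `X` torsion, `ι g = ϖ · L_p(f, α)` with `g ∈ char X = (fE)`, `g = fE · h`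
  obtain ⟨hX, g, hgmem, hιg⟩ := hW16 W p hp hordp hred hκ hγ hγ' hf D ϖ hϖ
  obtain ⟨fE, hchar⟩ := (charIdeal_isPrincipal_holds p D.X).principal
  have hchar' : D.charIdeal = Ideal.span {fE} := hchar
  have hgmem' : g ∈ Ideal.span {fE} := by rw [← hchar']; exact hgmem
  obtain ⟨h, hgh⟩ := Ideal.mem_span_singleton'.mp hgmem'
  have hfac : fE * h = g := by rw [mul_comm]; exact hgh
  have hιg' : iwasawaToPowerSeries p (fE * h) =
      C (ϖ : ℚ_[p]) * padicLFunction f (unitRoot W p : ℚ_[p]) := by rw [hfac, hιg]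
  have hg0 : fE * h ≠ 0 := mul_ne_zero_of_iota_eq hgood hord hf hϖ D hιg'
  have hfE0 : fE ≠ 0 := fun e ↦ hg0 (by rw [e, zero_mul])
  -- `fE(0) = 0` (rank ≥ 1, BMS (1)) and `ord_p [T¹](fE·h) = vc ≠ 0`
  have hfE00 : constantCoeff fE = 0 :=
    constantCoeff_charGenerator_eq_zero hS hMT hp hgood hord (by rw [hrk]) hκ hγ hγ' D hX hchar'
  have hval : ((coeff 1 (fE * h) : ℤ_[p]) : ℚ_[p]).valuation = vc :=
    hc.valuation_coeff_one_eq hf hϖ hιg'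
  have hne : coeff 1 (fE * h) ≠ 0 := by
    intro h0
    rw [h0, PadicInt.coe_zero, Padic.valuation_zero] at hval
    exact hvc hval.symm
  obtain ⟨hc1, hh0, hsum⟩ := valuation_coeff_one_mul_eq hfE00 hne
  rw [hval] at hsum
  have hvh : 0 ≤ ((constantCoeff h : ℤ_[p]) : ℚ_[p]).valuation := PadicInt.valuation_coe_nonneg
  -- `ord_T fE = 1 = rank`
  have hordfE : fE.order = W.mordellWeilRank := by
    rw [hrk, show ((1 : ℕ) : ℕ∞) = ((1 : ℕ) : ℕ∞) from rfl, order_eq_nat]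
    refine ⟨hc1, fun i hi ↦ ?_⟩
    obtain rfl : i = 0 := by omega
    rw [coeff_zero_eq_constantCoeff_apply, hfE00]
  -- BMS (2)–(3) at `(D, fE, Dh)` for every canonical `Dh`
  have key : ∀ Dh : PAdicHeightData W p, Dh.IsCanonical →
      SchneiderConjecture Dh ∧ Finite (AddCommGroup.primaryComponent W.sha p) ∧
      (padicValNat p (Nat.card (AddCommGroup.primaryComponent W.sha p)) : ℤ) +
          ((constantCoeff h : ℤ_[p]) : ℚ_[p]).valuation + (padicRegulator Dh).valuation +
          padicValNat p W.tamagawaProduct + 2 * padicValNat p (W.reductionPointCount p) =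
        vc + 1 + 2 * padicValNat p W.torsionOrder := by
    intro Dh hDh
    obtain ⟨-, hS2, hS3⟩ := hS W p hp hgood hord κ γ hκ hγ hγ' D hX fE hchar' Dh hDh
    obtain ⟨hSch, hfin⟩ := hS2.mp hordfE
    obtain ⟨u, hu⟩ := hS3 hSch hfin
    rw [hrk, pow_one] at hu
    haveI : Finite (AddCommGroup.primaryComponent W.sha p) := hfin
    -- abbreviations in `ℚ_p`
    set c1 : ℚ_[p] := ((coeff 1 fE : ℤ_[p]) : ℚ_[p]) with hc1def
    set lg : ℚ_[p] := padicLog p (cyclotomicGenerator p) with hlg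
    set Tt : ℚ_[p] := (W.torsionOrder : ℚ_[p]) with hTt
    set ε : ℚ_[p] := (1 - (unitRoot W p : ℚ_[p])⁻¹) with hε
    set Shp : ℚ_[p] := (Nat.card (AddCommGroup.primaryComponent W.sha p) : ℚ_[p]) with hShp
    set Rg : ℚ_[p] := padicRegulator Dh with hRg
    set Cc : ℚ_[p] := (W.tamagawaProduct : ℚ_[p]) with hCc
    -- non-vanishing of every factor
    have hc10 : c1 ≠ 0 := by rw [hc1def]; exact PadicInt.coe_ne_zero.mpr hc1
    obtain ⟨u₃, hu₃⟩ := exists_unit_padicLog_cyclotomicGenerator p hp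
    have hp0 : (p : ℚ_[p]) ≠ 0 := Nat.cast_ne_zero.mpr hpP.ne_zero
    have hlg' : lg = (p : ℚ_[p]) * ((u₃ : ℤ_[p]) : ℚ_[p]) := by rw [hlg]; exact hu₃
    have hlg0 : lg ≠ 0 := by rw [hlg']; exact mul_ne_zero hp0 (coe_units_ne_zero p u₃)
    have hTt0 : Tt ≠ 0 := by rw [hTt]; exact_mod_cast (W.torsionOrder_pos_holds).ne'
    obtain ⟨u₂, hu₂⟩ := exists_unit_one_sub_unitRoot_inv p W hordp
    have hε' : ε = ((u₂ : ℤ_[p]) : ℚ_[p]) * (W.reductionPointCount p : ℚ_[p]) := by rw [hε]; exact hu₂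
    have hN0 : (W.reductionPointCount p : ℚ_[p]) ≠ 0 := by
      exact_mod_cast (W.reductionPointCount_pos p).ne'
    have hε0 : ε ≠ 0 := by rw [hε']; exact mul_ne_zero (coe_units_ne_zero p u₂) hN0
    have hShp0 : Shp ≠ 0 := by rw [hShp]; exact_mod_cast Nat.card_pos.ne'
    have hRg0 : Rg ≠ 0 := hSch
    have hCc0 : Cc ≠ 0 := by
      rw [hCc]; exact_mod_cast (W.tamagawaProduct_pos_holds : 0 < W.tamagawaProduct).ne'
    -- valuations of the factors
    have hvlg : lg.valuation = 1 := by
      rw [hlg', Padic.valuation_mul hp0 (coe_units_ne_zero p u₃), Padic.valuation_p,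
        valuation_coe_units_eq_zero, add_zero]
    have hvT : Tt.valuation = (padicValNat p W.torsionOrder : ℤ) := by
      rw [hTt, Padic.valuation_natCast]
    have hvε : ε.valuation = (padicValNat p (W.reductionPointCount p) : ℤ) := by
      rw [hε', Padic.valuation_mul (coe_units_ne_zero p u₂) hN0, valuation_coe_units_eq_zero, zero_add,
        Padic.valuation_natCast]
    have hvS : Shp.valuation =
        (padicValNat p (Nat.card (AddCommGroup.primaryComponent W.sha p)) : ℤ) := by
      rw [hShp, Padic.valuation_natCast]
    have hvC : Cc.valuation = (padicValNat p W.tamagawaProduct : ℤ) := by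
      rw [hCc, Padic.valuation_natCast]
    -- valuations in the leading-term identity `c1 · lg · Tt² = u · (ε² · (Shp · (Rg · Cc)))`
    have hid := congrArg Padic.valuation hu
    rw [Padic.valuation_mul (mul_ne_zero hc10 hlg0) (pow_ne_zero 2 hTt0), Padic.valuation_mul hc10 hlg0,
      Padic.valuation_pow,
      Padic.valuation_mul (coe_units_ne_zero p u) (mul_ne_zero (pow_ne_zero 2 hε0)
        (mul_ne_zero (mul_ne_zero hShp0 hRg0) hCc0)),
      valuation_coe_units_eq_zero, zero_add,
      Padic.valuation_mul (pow_ne_zero 2 hε0) (mul_ne_zero (mul_ne_zero hShp0 hRg0) hCc0),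
      Padic.valuation_pow, Padic.valuation_mul (mul_ne_zero hShp0 hRg0) hCc0,
      Padic.valuation_mul hShp0 hRg0, hvlg, hvT, hvε, hvS, hvC] at hid
    refine ⟨hSch, hfin, ?_⟩
    push_cast at hid hsum ⊢
    linarith
  obtain ⟨Dh₀, hDh₀, -⟩ := existsUnique_isCanonical_of_odd hMT W p hp hgood hord
  obtain ⟨-, hfin, -⟩ := key Dh₀ hDh₀
  exact ⟨hX, hfin, fE, h, hchar', hfE0, hιg', hh0, hvh, fun Dh hDh ↦
    ⟨(key Dh hDh).1, (key Dh hDh).2.2⟩⟩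

/-- **ROUTE R — the regulator squeeze, at one cyclotomic datum.** Setting of `identity` plus the
certificate: `v ≤ ord_p Reg_p` at the canonical datum (`hv`) and `hb : vc + 1 + 2·ord_p #E(ℚ)_tors ≤
v + ord_p ∏c_ℓ + 2·ord_p #Ẽ(𝔽_p)`. Then `ord_p h(0) = 0`, `h ∈ Λˣ`, `char X = (g)` with
`ι g = ϖ·L_p(f,α)` (MAZUR'S MAIN CONJECTURE at `D`); `#Ш(E/ℚ)[p^∞] = 1`; Schneider and `ord_p Reg_p = v`
EXACTLY at every canonical datum. [cite: Wuthrich2014, Thm. 16 (p. 397)]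
[cite: BalakrishnanMullerStein2015, Thm. 1.7] [cite: MazurSteinTate2006, Thm. 1.3] [cite: Washington1997, §7.1] -/
theorem core (hW16 : Wuthrich2014.charIdeal_dvd_padicLFunction)
    (hS : Schneider1985_order_charGenerator_odd) (hMT : mazur_tate_sigma_exists_odd) (hp : p ≠ 2)
    (hgood : W.HasGoodReductionAtPrime p) (hord : ¬ (p : ℤ) ∣ W.frobeniusTrace p)
    (hred : ¬ W.HasIrreducibleModPGaloisRep p) (hrk : W.mordellWeilRank = 1)
    {vc : ℤ} (hvc : vc ≠ 0) (hc : AnalyticCoeffOneVal W p vc)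
    {v : ℤ} (hv : ∀ Dh : PAdicHeightData W p, Dh.IsCanonical → v ≤ (padicRegulator Dh).valuation)
    (hb : vc + 1 + 2 * padicValNat p W.torsionOrder ≤
      v + padicValNat p W.tamagawaProduct + 2 * padicValNat p (W.reductionPointCount p))
    {κ : ZpExtension ℚ p} {γ : Field.absoluteGaloisGroup ℚ}
    (hκ : κ.IsCyclotomic) (hγ : κ.IsTopGenerator γ) (hγ' : IsCyclotomicVariable p γ)
    [NeZero (W.conductorNorm ℤ)] {f : CuspForm (Gamma0 (W.conductorNorm ℤ)) 2} (hf : IsNewformOf W f)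
    {ϖ : ℚ} (hϖ : (ϖ : ℝ) * W.realPeriodRat = plusPeriod f) (D : W.SelmerDualData κ γ)
    [Module.Finite (IwasawaAlgebra p) D.X] :
    D.IsTorsion ∧
      (∃ g : IwasawaAlgebra p, D.charIdeal = Ideal.span {g} ∧
        iwasawaToPowerSeries p g = C (ϖ : ℚ_[p]) * padicLFunction f (unitRoot W p : ℚ_[p])) ∧
      Nat.card (AddCommGroup.primaryComponent W.sha p) = 1 ∧
      ∀ Dh : PAdicHeightData W p, Dh.IsCanonical →
        SchneiderConjecture Dh ∧ (padicRegulator Dh).valuation = v := by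
  obtain ⟨hX, hfin, fE, h, hchar', hfE0, hιg', hh0, hvh, key⟩ :=
    identity hW16 hS hMT hp hgood hord hred hrk hvc hc hκ hγ hγ' hf hϖ D
  haveI : Finite (AddCommGroup.primaryComponent W.sha p) := hfin
  -- the squeeze at the canonical datum: both `ord_p #Ш[p^∞]` and `ord_p h(0)` vanish, `ord_p Reg_p = v`
  have sq : ∀ Dh : PAdicHeightData W p, Dh.IsCanonical → SchneiderConjecture Dh ∧
      (padicRegulator Dh).valuation = v ∧
      padicValNat p (Nat.card (AddCommGroup.primaryComponent W.sha p)) = 0 ∧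
      ((constantCoeff h : ℤ_[p]) : ℚ_[p]).valuation = 0 := by
    intro Dh hDh
    obtain ⟨hSch, hid⟩ := key Dh hDh
    have hvR := hv Dh hDh
    have hS0 : (0 : ℤ) ≤ padicValNat p (Nat.card (AddCommGroup.primaryComponent W.sha p)) := by
      exact_mod_cast Nat.zero_le _
    refine ⟨hSch, by linarith, ?_, by linarith⟩
    have : (padicValNat p (Nat.card (AddCommGroup.primaryComponent W.sha p)) : ℤ) = 0 := by linarith
    exact_mod_cast this
  obtain ⟨Dh₀, hDh₀, -⟩ := existsUnique_isCanonical_of_odd hMT W p hp hgood hord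
  obtain ⟨-, -, hS0, hh0v⟩ := sq Dh₀ hDh₀
  -- `h(0) ∈ ℤ_pˣ`, so `h ∈ Λˣ` and `char X = (fE) = (fE · h)`
  have hunit : IsUnit h := isUnit_of_valuation_constantCoeff_eq_zero hh0 hh0v
  -- `#Ш[p^∞]` is a power of `p` of valuation `0`, i.e. `1`
  have hcard : Nat.card (AddCommGroup.primaryComponent W.sha p) = 1 := by
    obtain ⟨n, hn⟩ := exists_card_addPrimaryComponent_eq_pow (A := W.sha) p
    rw [hn, padicValNat.prime_pow] at hS0
    rw [hn, hS0, pow_zero]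
  refine ⟨hX, ⟨fE * h, ?_, hιg'⟩, hcard, fun Dh hDh ↦ ⟨(sq Dh hDh).1, (sq Dh hDh).2.1⟩⟩
  rw [hchar']
  exact ((span_eq_span_iff_isUnit hfE0 rfl).mpr hunit).symm

/-- **ROUTE R: `ord_p [T¹](ϖ·L_p) + 1 + 2·ord_p #E(ℚ)_tors ≤ v + ord_p ∏c_ℓ + 2·ord_p #Ẽ(𝔽_p)`,
`v ≤ ord_p Reg_p` ⇒ MAZUR'S MAIN CONJECTURE** (good ordinary Eisenstein pair, `p ≠ 2`, `rank E(ℚ) = 1`;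
Wuthrich Thm. 16, BMS 1.7, Mazur–Tate `σ`, all PUBLISHED; no `λ_an`, `μ_an`, parity, descent, `#Ш_an`).
[cite: Wuthrich2014, Thm. 16 (p. 397)] [cite: BalakrishnanMullerStein2015, Thm. 1.7] -/
theorem mazurMainConjecture_of_coeffOneVal_of_regulatorGE
    (hW16 : Wuthrich2014.charIdeal_dvd_padicLFunction) (hS : Schneider1985_order_charGenerator_odd)
    (hMT : mazur_tate_sigma_exists_odd) (hp : p ≠ 2) (hgood : W.HasGoodReductionAtPrime p)
    (hord : ¬ (p : ℤ) ∣ W.frobeniusTrace p) (hred : ¬ W.HasIrreducibleModPGaloisRep p)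
    (hrk : W.mordellWeilRank = 1) {vc : ℤ} (hvc : vc ≠ 0) (hc : AnalyticCoeffOneVal W p vc)
    {v : ℤ} (hv : ∀ Dh : PAdicHeightData W p, Dh.IsCanonical → v ≤ (padicRegulator Dh).valuation)
    (hb : vc + 1 + 2 * padicValNat p W.torsionOrder ≤
      v + padicValNat p W.tamagawaProduct + 2 * padicValNat p (W.reductionPointCount p)) :
    MazurMainConjecture W p := by
  intro κ γ hκ hγ hγ' _ f hf ϖ hϖ D
  haveI : Module.Finite (IwasawaAlgebra p) D.X := D.module_finite_holds hγ
  obtain ⟨hX, hMC, -, -⟩ := core hW16 hS hMT hp hgood hord hred hrk hvc hc hv hb hκ hγ hγ' hf hϖ D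
  exact ⟨hX, hMC⟩

end Squeeze

/-! ## §3. On the rank-one leaf X1 ∩ {r = 1}: Mazur's MC `∧ BSD(E,p)`, `Ш[p^∞] = 0`, isogeny form -/

section Leaf

variable {W : WeierstrassCurve ℚ} [W.IsElliptic] [W.IsGloballyMinimal] {p : ℕ} [Fact p.Prime]

/-- **ROUTE R ON THE RANK-ONE LEAF — HEADLINE: `ord_p [T¹](ϖ·L_p(E,T)) + 1 + 2·ord_p #E(ℚ)_tors ≤
v + ord_p ∏c_ℓ + 2·ord_p #Ẽ(𝔽_p)`, `v ≤ ord_p Reg_p(E)` ⇒ Mazur's main conjecture `∧ BSD(E,p)`.** TWO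
finite `p`-adic certificates per pair: the valuation `vc ≠ 0` of ONE modular-symbol coefficient
(`AnalyticCoeffOneVal W p vc`; engines C / B) and a lower bound `v` on the valuation of THE canonical
cyclotomic `p`-adic regulator (census currency as in x1b's route P₃: `v = v_p(h_p(P)) + 1`, `h_p` the
Mazur–Stein–Tate `σ`-height of a `p`-saturated generator, `⟨P,P⟩ = -2p·h_p(P)`; engines x1b engine 3 /
PARI `ellpadicregulator`), plus `#E(ℚ)_tors`, `∏c_ℓ`, `#Ẽ(𝔽_p)`. `BSD(E,p)` via x1a's
`RankOne.Leaf.bsdp_of_mazurMainConjecture_of_schneider`, the coefficient being the Schneider certificate.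
Either Greenberg–Vatsal type; any `λ_an`; NO `#Ш(E/ℚ)_an`. [cite: Wuthrich2014, Thm. 16 (p. 397)]
[cite: BalakrishnanMullerStein2015, Thm. 1.7] [cite: MazurSteinTate2006, Thm. 1.3 and §4]
[cite: PerrinRiou1987, §1.4 Cor. 1.8] [cite: SteinWuthrich2013, §4.2 and Thm. 6.1] -/
theorem _root_.Summit.BirchSwinnertonDyer.Rank1Residual.X1.RankOne.Leaf.mazurMainConjecture_and_bsdp_of_coeffOneVal_of_regulatorGE
    (hW16 : Wuthrich2014.charIdeal_dvd_padicLFunction) (hS : Schneider1985_order_charGenerator_odd)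
    (hPR : perrinRiou_rankOne_leadingTerms_odd) (hMT : mazur_tate_sigma_exists_odd)
    (hmod : nonempty_modularParametrizationData) (hGZK : rank_eq_analyticRank_of_analyticRank_le_one)
    (hL : RankOne.Leaf W p) {vc : ℤ} (hvc : vc ≠ 0) (hc : AnalyticCoeffOneVal W p vc)
    {v : ℤ} (hv : ∀ Dh : PAdicHeightData W p, Dh.IsCanonical → v ≤ (padicRegulator Dh).valuation)
    (hb : vc + 1 + 2 * padicValNat p W.torsionOrder ≤
      v + padicValNat p W.tamagawaProduct + 2 * padicValNat p (W.reductionPointCount p)) :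
    MazurMainConjecture W p ∧ BSDp W p := by
  have hX := isClassX1_of_classX1 hL.1
  have hMC : MazurMainConjecture W p :=
    mazurMainConjecture_of_coeffOneVal_of_regulatorGE hW16 hS hMT hX.two_ne hX.hasGoodReductionAtPrime
      hX.not_dvd_frobeniusTrace hX.not_hasIrreducibleModPGaloisRep (hL.mordellWeilRank_eq_one hGZK)
      hvc hc hv hb
  exact ⟨hMC, hL.bsdp_of_mazurMainConjecture_of_schneider hS hPR hMT hmod hGZK
    (hL.schneider_of_coeffOneVal hPR hGZK hmod hc hvc) hMC⟩

/-- **Route R pins `Ш`: under the same certificate `#Ш(E/ℚ)[p^∞] = 1`**, and the canonical regulator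
has valuation EXACTLY `v` with Schneider's non-degeneracy (the certificate only fires at
`v = ord_p Reg_p`). Facts: Wuthrich Thm. 16, BMS 1.7, Mazur–Tate `σ`, modularity, GZK; a cyclotomic
datum exists (`exists_isCyclotomic_isTopGenerator_isCyclotomicVariable_holds`, `nonempty_selmerDualData_holds`).
[cite: Wuthrich2014, Thm. 16 (p. 397)] [cite: BalakrishnanMullerStein2015, Thm. 1.7] -/
theorem _root_.Summit.BirchSwinnertonDyer.Rank1Residual.X1.RankOne.Leaf.card_shaPrimary_eq_one_of_coeffOneVal_of_regulatorGE
    (hW16 : Wuthrich2014.charIdeal_dvd_padicLFunction) (hS : Schneider1985_order_charGenerator_odd)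
    (hMT : mazur_tate_sigma_exists_odd) (hmod : nonempty_modularParametrizationData)
    (hGZK : rank_eq_analyticRank_of_analyticRank_le_one)
    (hL : RankOne.Leaf W p) {vc : ℤ} (hvc : vc ≠ 0) (hc : AnalyticCoeffOneVal W p vc)
    {v : ℤ} (hv : ∀ Dh : PAdicHeightData W p, Dh.IsCanonical → v ≤ (padicRegulator Dh).valuation)
    (hb : vc + 1 + 2 * padicValNat p W.torsionOrder ≤
      v + padicValNat p W.tamagawaProduct + 2 * padicValNat p (W.reductionPointCount p)) :
    Nat.card (AddCommGroup.primaryComponent W.sha p) = 1 ∧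
      ∀ Dh : PAdicHeightData W p, Dh.IsCanonical →
        SchneiderConjecture Dh ∧ (padicRegulator Dh).valuation = v := by
  have hX := isClassX1_of_classX1 hL.1
  obtain ⟨κ, hκ, γ, hγ, hγ'⟩ := exists_isCyclotomic_isTopGenerator_isCyclotomicVariable_holds p
  obtain ⟨D⟩ := W.nonempty_selmerDualData_holds κ γ hγ
  haveI : NeZero (W.conductorNorm ℤ) := ⟨(W.conductorNorm_pos_holds).ne'⟩
  obtain ⟨Dm⟩ := hmod W
  obtain ⟨ϖ, -, hϖ, -⟩ := Dm.exists_rat_mul_realPeriodRat_eq_plusPeriod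
  haveI : Module.Finite (IwasawaAlgebra p) D.X := D.module_finite_holds hγ
  obtain ⟨-, -, hcard, hReg⟩ := core hW16 hS hMT hX.two_ne hX.hasGoodReductionAtPrime
    hX.not_dvd_frobeniusTrace hX.not_hasIrreducibleModPGaloisRep (hL.mordellWeilRank_eq_one hGZK) hvc hc
    hv hb hκ hγ hγ' Dm.isNewformOf hϖ D
  exact ⟨hcard, hReg⟩

/-- **Booking (isogeny) form: the certificates may be read on ANY globally minimal curve `E' ∼ E` of
the class** (the leaf transports, `RankOne.Leaf.of_isIsogenous`; route R at `(E', p)`; Cassels' isogeny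
invariance of `BSD(·,p)` at analytic rank `≤ 1`, `Rank1ResidualX1Isogeny.bsdp_iff_of_isIsogenous`).
`Reg_p`, `#E(ℚ)_tors`, `∏c_ℓ` are read on `E'`; `vc` and `#Ẽ(𝔽_p)` are class invariants.
[cite: Wuthrich2014, Thm. 16 (p. 397)] [cite: BalakrishnanMullerStein2015, Thm. 1.7]
[cite: PerrinRiou1987, §1.4 Cor. 1.8] [cite: MilneADT2006, Thm. I.7.3] -/
theorem _root_.Summit.BirchSwinnertonDyer.Rank1Residual.X1.RankOne.Leaf.bsdp_of_isIsogenous_of_coeffOneVal_of_regulatorGE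
    (hW16 : Wuthrich2014.charIdeal_dvd_padicLFunction) (hS : Schneider1985_order_charGenerator_odd)
    (hPR : perrinRiou_rankOne_leadingTerms_odd) (hMT : mazur_tate_sigma_exists_odd)
    (hmod : nonempty_modularParametrizationData) (hmod' : hasEntireLFunction_rat)
    (hGZK : rank_eq_analyticRank_of_analyticRank_le_one) (hCassels : bsdRHS_eq_of_isIsogenous)
    (hL : RankOne.Leaf W p) {W' : WeierstrassCurve ℚ} [W'.IsElliptic] [W'.IsGloballyMinimal]
    (hiso : IsIsogenous W W') {vc : ℤ} (hvc : vc ≠ 0) (hc : AnalyticCoeffOneVal W' p vc)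
    {v : ℤ} (hv : ∀ Dh : PAdicHeightData W' p, Dh.IsCanonical → v ≤ (padicRegulator Dh).valuation)
    (hb : vc + 1 + 2 * padicValNat p W'.torsionOrder ≤
      v + padicValNat p W'.tamagawaProduct + 2 * padicValNat p (W'.reductionPointCount p)) :
    BSDp W p :=
  (Rank1ResidualX1Isogeny.bsdp_iff_of_isIsogenous hGZK hmod' hCassels W W' hiso p (by rw [hL.2])).mpr
    ((hL.of_isIsogenous hiso).mazurMainConjecture_and_bsdp_of_coeffOneVal_of_regulatorGE hW16 hS hPR
      hMT hmod hGZK hvc hc hv hb).2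

end Leaf

end Summit.BirchSwinnertonDyer.Rank1Residual.X1.RankOneRegulatorSqueeze

end
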